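import Summits.QuantumFields.BalabanUV.T4Continuum.Support.ShellMeasureLandauDerivativeDecaySq
import Summits.QuantumFields.BalabanUV.T4Continuum.Support.ShellMeasureDecayKernelBinders

/-!
# `T4Continuum.ShellMeasureLandauDerivativeDecayTorus` — WALL §2 (a) item (P4), row S67 file 3: THE TORUS INSTANCE
# and the CAPSTONE JUNCTION — on bond fields placed in `(ℤ∕Tℤ)ᵈ` (periodic ℓ¹ distance `pl1`), the (73)-TYPE decay
# display for the Landau correction `D` that the crew's S66 f3b `binders_of_decay_torus` takes as INPUT (`hker`, `hkD`)
# is PRODUCED from END-II's ∕ S64's binder pair for `C` + LOCALITY + a (46)-TYPE decaying kernel `H` + (55) +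
# smallness, and f3b is FIRED: file 2b's binders `hMb`∕`hM'` for `M = H ∘ D` with EXPLICIT volume-free constants and
# NO (73) display left among the hypotheses (cell `pub-balaban`, sub-cell `t4`, spine estimate NE7c (node U5b); NE7c
# ROUND-2 crew, unit `b2b-balaban-t4-ne7c-formalise-leaf-08` gen 12, owner table `LEAVES-NE7c-P1.md` row S67 (owner g30
# GO); imports file 2 `ShellMeasureLandauDerivativeDecaySq` (p223296) and the crew's S66 f3b `ShellMeasureDecayKernelBinders`
# (leaf-06-g4, p222452) ONLY; [folklore]; 0 def, 0 `def … : Prop`, 0 sorry)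

HONEST FRAMING.  Finite four-torus programme, rung (B)+1 only — NOT infinite volume, NOT a mass gap, NOT the Clay
problem, NOT summit progress; (B), `BetaPertHyp`, (B^μ) are not consumed.  NE7c (`T4IndicatorShell.ShellWeightBound`)
is NOT PRINTED and NOT PROVED; «NE7c ⇐ the named binders» (WALL `t4/b2b-balaban-t4-ne7c-p1/WALL-NE7c-P1.md` §2).
Bookkeeping on OUR side; nothing printed is asserted or cited as a fact.  [Balaban1985Variational] (73) p. 289, (46)
(= [5] Thm 3.12, the deep wall), (44)∕(55), B7 (89) are LOCATORS for the SHAPES of the hypotheses.  HONEST DEPENDENCY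
(cell): continuum YM on T⁴ ⇐ BetaPertH ∧ nine spine estimates (0/9 proved); BetaPertH ⇐ (D1) ∧ (D4) ∧ CAP+tail;
G-an2-4 gates asym, D1 and NE2/3/4.

CONTENT (one grid `Λ`, fibre `𝔄` over ℂ, placement `pos : Λ → (ℤ∕Tℤ)ᵈ` with at most `m` bonds per site):
* §1 `weightedRowSum_kernel_torus`: a kernel `‖hH e c‖ ≤ h₀e^{−δ_H·pl1(pos e − pos c)}` has `e^{δ·pl1}`-WEIGHTED row sums
  `≤ h₀·m·K₁ d (δ_H − δ)` for every `δ < δ_H` (the crew's f3a torus engine `sum_exp_pl1_comp_le` at the surplus rate —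
  B6 (2.68)'s mechanism: the rate drops, the constant stays volume-free); `kerOp_single_majorant` (the operator
  `kerOp hH` has the real majorant `‖hH b′ c′‖`).
* §2 **`entry_fderiv_decay_torus`** = file 2's `entry_fderiv_decay_of_sq_bound` with `d := pl1`, `H := kerOp hH`,
  `h_w := h₀·m·K₁ d (δ_H − δ)`: for every `A ∈ ball 0 r`, `‖entry (DD(A)) c b‖ ≤ (16C₂m₀e^{δr₀})·‖A‖·e^{−δ·pl1(pos c −
  pos b)}` — f3b's `hkD` VERBATIM, `c₀ = 16C₂m₀e^{δr₀}`, any `0 ≤ δ < δ_H`.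
* §3 **`binders_torus_of_sq_bound`** — THE CAPSTONE: f3b's `binders_of_decay_torus` FIRED with `kD A := entry (DD(A))`
  (`hker` by file 2's `kerOp_entry`), giving file 2b's ROW binder `‖(H∘D) A‖ ≤ m₀′‖A‖²` and COLUMN binder
  `‖D(H∘D)(A)(ι_b X)‖₁ ≤ m₁′‖A‖‖X‖` on `ball 0 r` with `m₀′ = m₁′ = (h₀·m·K₁ d δ_H)·(16C₂m₀e^{δr₀}·m·K₁ d δ)` — from (hCq,
  hCd, locality, `hH`'s decay, (55), smallness) ALONE.
NOT HERE (said): `M₃ = H∘D₃` (the `𝔇₂` remark — crew S66 f3c `ShellMeasureDecayKernelTail`), `K = Δ_π H D` (one more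
(3.132)-TYPE layer, f3b's `prop4Hyp_termsHD_of_decay_torus` pattern), the identification of `C`, `H`, `D`, `pos`, `loc`
with Bałaban's sectioned objects ([dict], node O).  No estimate of Bałaban's at a live level is discharged; NOTHING in
the countdown moves.
-/

noncomputable section

open Metric Set Filter Finset
open scoped Topology

namespace Summit.QuantumFields.BalabanUV.T4Continuum.ShellMeasureLandauDerivativeDecayTorus

open Literature.MathematicalPhysics.QuantumFieldTheory.Balaban1983to89
open B12Decay510Window (K₁ K₁_nonneg)
open TreeLengthTorus (TPt)
open B12Decay510Torus (pl1 pl1_nonneg pl1_sub_comm pl1_sub_triangle)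
open ShellMeasureDecayKernelSums (kerOp kerOp_apply kerOp_single sum_exp_pl1_comp_le)
open ShellMeasureGradientTailPairing (norm₁)
open ShellMeasureDecayKernelBinders (binders_of_decay_torus)
open ShellMeasureLandauDerivativeDecay (entry entry_apply)
open ShellMeasureLandauDerivativeDecaySq (kerOp_entry entry_fderiv_decay_of_sq_bound)

variable {Λ : Type*} [Fintype Λ] [DecidableEq Λ] {𝔄 : Type*} [NormedAddCommGroup 𝔄] [NormedSpace ℂ 𝔄]
variable {d T : ℕ} [NeZero T]

/-! ## §1 The (46)-TYPE kernel on the torus: majorant and weighted row sums at a surplus rate -/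

omit [NeZero T] in
/-- The kernel operator `kerOp hH` has the real majorant `‖hH b′ c′‖`: `‖kerOp hH (ι_{c′} a) b′‖ ≤ ‖hH b′ c′‖·‖a‖`.
[folklore] -/
theorem kerOp_single_majorant (hH : Λ → Λ → (𝔄 →L[ℂ] 𝔄)) (c' : Λ) (a : 𝔄) (b' : Λ) :
    ‖kerOp hH (Pi.single c' a) b'‖ ≤ ‖hH b' c'‖ * ‖a‖ := by
  rw [kerOp_single]
  exact (hH b' c').le_opNorm a

omit [DecidableEq Λ] in
/-- **WEIGHTED ROW SUMS AT A SURPLUS RATE, VOLUME-FREE.**  A kernel dominated by `h₀·e^{−δ_H·pl1(pos e − pos c)}` on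
indices placed in `(ℤ∕Tℤ)ᵈ` (at most `m` per site) has `e^{δ·pl1}`-weighted row sums `≤ h₀·m·K₁ d (δ_H − δ)` for every
`δ < δ_H` — the crew's f3a engine `sum_exp_pl1_comp_le` at the rate `δ_H − δ > 0`. [folklore] -/
theorem weightedRowSum_kernel_torus (pos : Λ → TPt d T) {m : ℕ}
    (hm : ∀ x, (Finset.univ.filter fun b => pos b = x).card ≤ m) {h₀ δH δ : ℝ} (hh₀ : 0 ≤ h₀) (hδ : δ < δH)
    (b' : Λ) :
    ∑ c', h₀ * Real.exp (-(δH * pl1 (pos b' - pos c'))) * Real.exp (δ * pl1 (pos b' - pos c'))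
      ≤ h₀ * (m * K₁ d (δH - δ)) := by
  have hrate : 0 < δH - δ := by linarith
  calc ∑ c', h₀ * Real.exp (-(δH * pl1 (pos b' - pos c'))) * Real.exp (δ * pl1 (pos b' - pos c'))
      = h₀ * ∑ c', Real.exp (-((δH - δ) * pl1 (pos b' - pos c'))) := by
        rw [Finset.mul_sum]
        refine Finset.sum_congr rfl fun c' _ => ?_
        rw [mul_assoc, ← Real.exp_add]
        congr 1
        ring_nf
    _ ≤ h₀ * (m * K₁ d (δH - δ)) := mul_le_mul_of_nonneg_left (sum_exp_pl1_comp_le pos hm hrate (pos b')) hh₀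

/-! ## §2 File 2 on the torus: f3b's `hkD` for the Landau correction, derived -/

/-- **(73)-TYPE DISPLAY FOR `D` ON THE TORUS, DERIVED** (f3b's `hkD` verbatim with `c₀ = 16C₂m₀e^{δr₀}`).  Placement
`pos : Λ → (ℤ∕Tℤ)ᵈ` (≤ `m` bonds per site); `C` with END-II's ∕ S64's pair (`DifferentiableOn ℂ C (ball 0 R)`,
`‖C Z‖ ≤ C₂‖Z‖²`) and LOCAL (`C Z c` depends only on `Z` on `loc c`, `#loc c ≤ m₀`, `pl1(pos c − pos b′) ≤ r₀` on
`loc c`); `H = kerOp hH` with `‖hH e c‖ ≤ h₀e^{−δ_H·pl1(pos e − pos c)}` ((46) TYPE — the deep wall, displayed); `D`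
differentiable on `ball 0 r` with the fixed-point identity (49) there and (55) `‖D A‖ ≤ 4C₂‖A‖²`; a rate `0 ≤ δ < δ_H`;
smallness `4r ≤ R`, `4C₂h_w r ≤ 1`, `16C₂m₀e^{δr₀}h_w r ≤ 1` with `h_w = h₀·m·K₁ d (δ_H − δ)`.  Then for every
`A ∈ ball 0 r` and all bonds `c`, `b`: `‖entry (DD(A)) c b‖ ≤ (16C₂m₀e^{δr₀})·‖A‖·e^{−δ·pl1(pos c − pos b)}`. [folklore] -/
theorem entry_fderiv_decay_torus (pos : Λ → TPt d T) {m : ℕ}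
    (hm : ∀ x, (Finset.univ.filter fun b => pos b = x).card ≤ m)
    {C D : (Λ → 𝔄) → (Λ → 𝔄)} {R C₂ r : ℝ} (hC₂ : 0 ≤ C₂)
    (hCd : DifferentiableOn ℂ C (ball 0 R)) (hCq : ∀ Z ∈ ball (0 : Λ → 𝔄) R, ‖C Z‖ ≤ C₂ * ‖Z‖ ^ 2)
    (loc : Λ → Finset Λ) {m₀ : ℕ} {r₀ : ℝ} (hcard : ∀ c, (loc c).card ≤ m₀)
    (hdist : ∀ c, ∀ b' ∈ loc c, pl1 (pos c - pos b') ≤ r₀)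
    (hloc : ∀ c, ∀ Z Z' : Λ → 𝔄, (∀ b ∈ loc c, Z b = Z' b) → C Z c = C Z' c)
    (hH : Λ → Λ → (𝔄 →L[ℂ] 𝔄)) {h₀ δH δ : ℝ} (hh₀ : 0 ≤ h₀) (hδ0 : 0 ≤ δ) (hδ : δ < δH)
    (hh : ∀ e c, ‖hH e c‖ ≤ h₀ * Real.exp (-(δH * pl1 (pos e - pos c))))
    (hD : DifferentiableOn ℂ D (ball 0 r)) (hfix : ∀ x ∈ ball (0 : Λ → 𝔄) r, D x = C (x - kerOp hH (D x)))
    (h55 : ∀ A ∈ ball (0 : Λ → 𝔄) r, ‖D A‖ ≤ 4 * C₂ * ‖A‖ ^ 2)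
    (hrR : 4 * r ≤ R) (hsmall₁ : 4 * C₂ * (h₀ * (m * K₁ d (δH - δ))) * r ≤ 1)
    (hsmall₂ : 16 * C₂ * m₀ * Real.exp (δ * r₀) * (h₀ * (m * K₁ d (δH - δ))) * r ≤ 1) :
    ∀ A ∈ ball (0 : Λ → 𝔄) r, ∀ (c b : Λ),
      ‖entry (fderiv ℂ D A) c b‖ ≤
        (16 * C₂ * m₀ * Real.exp (δ * r₀)) * ‖A‖ * Real.exp (-(δ * pl1 (pos c - pos b))) :=
  entry_fderiv_decay_of_sq_bound (fun x y : TPt d T => pl1 (x - y)) (fun _ _ => pl1_nonneg _)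
    (fun x y z => pl1_sub_triangle x y z) pos pos hδ0 (kerOp hH) hC₂ hCd hCq loc hcard hdist hloc
    (fun b' c' => h₀ * Real.exp (-(δH * pl1 (pos b' - pos c'))))
    (fun _ _ => mul_nonneg hh₀ (Real.exp_nonneg _))
    (fun c' a b' => (kerOp_single_majorant hH c' a b').trans (mul_le_mul_of_nonneg_right (hh b' c') (norm_nonneg a)))
    (mul_nonneg hh₀ (mul_nonneg (Nat.cast_nonneg m) (K₁_nonneg d _)))
    (weightedRowSum_kernel_torus pos hm hh₀ hδ) hD hfix h55 hrR hsmall₁ hsmall₂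

/-! ## §3 The capstone junction: f3b FIRED — file 2b's binders for `M = H ∘ D` with no (73) display left -/

/-- **FILE 2b's BINDERS FOR `M = H ∘ D` FROM (hCq, hCd, LOCALITY, `hH`'s DECAY, (55), SMALLNESS) — ON THE TORUS,
VOLUME-FREE, EXPLICIT.**  Under the hypotheses of `entry_fderiv_decay_torus` with `0 < δ < δ_H` and `0 < r`, the crew's
S66 f3b `binders_of_decay_torus` applies with `kD A := entry (DD(A))` (`hker` by `kerOp_entry`, `hkD` by §2, `D 0 = 0`
by (55)), so `M := kerOp hH ∘ D` satisfies file 2b's ROW binder (`hMb` shape) AND COLUMN binder (`hM'` shape,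
`‖·‖₁ = norm₁`) with the SAME constant `(h₀·(m·K₁ d δ_H))·((16C₂m₀e^{δr₀})·(m·K₁ d δ))` — no `#Λ`, no `T`.  The only
DISPLAYED inputs left for the `H∘D` terms of B11 (80): `hH`'s decay ((46), [5] Thm 3.12 — deep), (44)∕(55), locality,
smallness. [folklore] -/
theorem binders_torus_of_sq_bound (pos : Λ → TPt d T) {m : ℕ}
    (hm : ∀ x, (Finset.univ.filter fun b => pos b = x).card ≤ m)
    {C D : (Λ → 𝔄) → (Λ → 𝔄)} {R C₂ r : ℝ} (hC₂ : 0 ≤ C₂) (hr : 0 < r)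
    (hCd : DifferentiableOn ℂ C (ball 0 R)) (hCq : ∀ Z ∈ ball (0 : Λ → 𝔄) R, ‖C Z‖ ≤ C₂ * ‖Z‖ ^ 2)
    (loc : Λ → Finset Λ) {m₀ : ℕ} {r₀ : ℝ} (hcard : ∀ c, (loc c).card ≤ m₀)
    (hdist : ∀ c, ∀ b' ∈ loc c, pl1 (pos c - pos b') ≤ r₀)
    (hloc : ∀ c, ∀ Z Z' : Λ → 𝔄, (∀ b ∈ loc c, Z b = Z' b) → C Z c = C Z' c)
    (hH : Λ → Λ → (𝔄 →L[ℂ] 𝔄)) {h₀ δH δ : ℝ} (hh₀ : 0 ≤ h₀) (hδ0 : 0 < δ) (hδ : δ < δH)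
    (hh : ∀ e c, ‖hH e c‖ ≤ h₀ * Real.exp (-(δH * pl1 (pos e - pos c))))
    (hD : DifferentiableOn ℂ D (ball 0 r)) (hfix : ∀ x ∈ ball (0 : Λ → 𝔄) r, D x = C (x - kerOp hH (D x)))
    (h55 : ∀ A ∈ ball (0 : Λ → 𝔄) r, ‖D A‖ ≤ 4 * C₂ * ‖A‖ ^ 2)
    (hrR : 4 * r ≤ R) (hsmall₁ : 4 * C₂ * (h₀ * (m * K₁ d (δH - δ))) * r ≤ 1)
    (hsmall₂ : 16 * C₂ * m₀ * Real.exp (δ * r₀) * (h₀ * (m * K₁ d (δH - δ))) * r ≤ 1) :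
    (∀ A ∈ ball (0 : Λ → 𝔄) r,
        ‖kerOp hH (D A)‖ ≤ h₀ * (m * K₁ d δH) * ((16 * C₂ * m₀ * Real.exp (δ * r₀)) * (m * K₁ d δ)) * ‖A‖ ^ 2) ∧
    (∀ A ∈ ball (0 : Λ → 𝔄) r, ∀ (b : Λ) (X : 𝔄),
        norm₁ (fderiv ℂ (fun A => kerOp hH (D A)) A (Pi.single b X)) ≤
          h₀ * (m * K₁ d δH) * ((16 * C₂ * m₀ * Real.exp (δ * r₀)) * (m * K₁ d δ) * ‖A‖) * ‖X‖) := by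
  have hδH : 0 < δH := hδ0.trans hδ
  -- `D 0 = 0` from (55) at the centre of the ball
  have hD0 : D 0 = 0 := by
    have h0 : (0 : Λ → 𝔄) ∈ ball (0 : Λ → 𝔄) r := mem_ball_self hr
    have h := h55 0 h0
    rw [norm_zero] at h
    exact norm_le_zero_iff.mp (by nlinarith [h])
  exact binders_of_decay_torus pos hm (by positivity) hδ0 hD hD0 (fun A => entry (fderiv ℂ D A))
    (fun A _ => (kerOp_entry (fderiv ℂ D A)).symm)
    (entry_fderiv_decay_torus pos hm hC₂ hCd hCq loc hcard hdist hloc hH hh₀ hδ0.le hδ hh hD hfix h55 hrR hsmall₁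
      hsmall₂)
    hH hh₀ hδH hh

end Summit.QuantumFields.BalabanUV.T4Continuum.ShellMeasureLandauDerivativeDecayTorus
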